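import Summits.BirchSwinnertonDyer.BirchSwinnertonDyer.Theses.EisensteinPrimes
import Literature.NumberTheory.EllipticCurves.KellerYin2024.AnomalousAnticyclotomicMainConjecture
import Literature.NumberTheory.EllipticCurves.GreenbergSelmerLatticeIndependence
import HarnessLib

/-!
# Crux `MazurMCOnX1RankZero` (item stmt-BirchSwinnertonDyer-19035), line `interlude_with_torsion`:
# crux 2 ∘ [Kobayashi–Ota 2020, Prop. 2.9] ⟹ the BDP value of the ANTICYCLOTOMIC Greenberg characteristic
# series at EVERY member of the isogeny class of the good lattice

Cell `bsd-eis` (host `run/shared/lean/pub/bsd-eis/`), lead `bsd-line-x1-p2` (g3); `--supports`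
stmt-BirchSwinnertonDyer-19035 as a HELPER (no registered stub: it serves the print-maximal re-route of
the line recorded in `Cruxes/MazurMCOnX1RankZero/Lines/interlude_with_torsion-REPORT.md` §3: crux 2 at
Keller–Yin's good lattice `E_g` → Kobayashi–Ota lattice independence on `K_∞⁻` → Wüthrich's lattice
`E_•` on `K_∞⁻` → [CGS25] Prop. 3.4.2 at `E_•` → `K_∞⁺`, print end to end on the sub-row
`E_•(K)[p] = 0`; the second arrow is `plusLineValue_of_minusLineValue` of
`EisensteinPrimesMazurMCOnX1RankZeroInterludeTwoLineTransport.lean`). No summit statement (BSD,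
Mazur's main conjecture, IMC2) is proved here. CONDITIONAL on crux 2 BY NAME (`GoodLatticeBDPValue` =
Keller–Yin Thm. 3.0.8 ∘ BDP, PREPRINT, open item 19032) and on the refereed named fact
`KobayashiOta2020.prop29_charIdeal_XGr_anticyclotomic_eq_of_isIsogenous` (p623352).

WHAT. In the data of crux 2 (the good lattice `W = E_g` at an anomalous Eisenstein `p > 2`: no
unramified rational `p`-line; `K` imaginary quadratic with (Heeg), (spl), `D_K` odd `≠ −3`,
`E_g(K)[p] = 0`, (Sel); `(ι, v, v̄)`; an ANTICYCLOTOMIC pair `(κ, γ)`; a modular parametrisation and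
Heegner datum), for EVERY `W'` rationally isogenous to `W`: `X_Gr(W'/K_∞⁻) = AcSelmer.XAc (W'.baseChange K)
p κ vbar ∅ γ` is `Λ`-torsion and its characteristic ideal is principal with a generator `𝓕` (the one crux
2 gives for `E_g`) whose constant term is `u · c_{E_g}⁻² (1 − a_p p⁻¹ + p⁻¹)² log_{ω_{E_g}}(P_K)²`,
`u ∈ ℤ_p^×` — the lattice-free BDP value written in `E_g`'s data.
[cite: KellerYin2024, Thm. 3.0.8 (IMC2)] [cite: KobayashiOta2020, Prop. 2.9 and its proof (pp. 551–552)]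
[cite: CastellaGrossiSkinner2025, remark after Prop. 3.2.3 (l. 1241–1243), §5 Step 1]
-/

set_option linter.dupNamespace false
set_option autoImplicit false

noncomputable section

open scoped Classical

open WeierstrassCurve NumberField IsDedekindDomain Field
  Literature.NumberTheory.EllipticCurves Literature.NumberTheory.EllipticCurves.ModularForms
  Literature.NumberTheory.EllipticCurves.Rank1Residual
  Literature.NumberTheory.EllipticCurves.Castella2018 Literature.NumberTheory.QuadraticFields

namespace Summit.BirchSwinnertonDyer.BirchSwinnertonDyer.Theorems.InterludeWithTorsion

/-- **crux 2 ∘ Kobayashi–Ota Prop. 2.9 ⟹ the anticyclotomic BDP value at every member of the class of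
the good lattice.** Hypotheses: `h2` = the route's crux 2 `GoodLatticeBDPValue` BY NAME; `hKO` = the
typed Kobayashi–Ota Prop. 2.9 (anticyclotomic lattice independence of `char X_Gr`). In the binders of
crux 2 (`KellerYin2024.thm308_imc2_bdpValue_goodLattice_OPEN`, verbatim) and for every `W'` with
`IsIsogenous W W'`: `X_Gr(W'/K_∞⁻)` is torsion, `char X_Gr(W'/K_∞⁻) = (𝓕)` with
`𝓕(0) = u · c_{E_g}⁻² (1 − a_p p⁻¹ + p⁻¹)² log_{ω_{E_g}}(P_K)²`. Proof: crux 2 gives torsion, `𝓕`, `u` at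
`W = E_g`; `hKO` (good `p` from `Good`, `v ∋ p` from `ι`) identifies the two characteristic ideals.
CONDITIONAL on `h2` (open) and `hKO` (refereed named fact); plumbing only.
[cite: KellerYin2024, Thm. 3.0.8 (IMC2)] [cite: KobayashiOta2020, Prop. 2.9 and its proof (pp. 551–552)] -/
theorem minusLineValue_class_of_goodLattice
    (h2 : Summit.BirchSwinnertonDyer.BirchSwinnertonDyer.Theses.EisensteinPrimes.GoodLatticeBDPValue)
    (hKO : KobayashiOta2020.prop29_charIdeal_XGr_anticyclotomic_eq_of_isIsogenous) :
    ∀ (W : WeierstrassCurve ℚ) [W.IsElliptic] [W.IsGloballyMinimal] (p : ℕ) [Fact p.Prime],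
      2 < p → Good W p → Red W p → Anom W p →
      (∀ Φ : AddSubgroup (geomTorsion W (p : ℤ)), IsRationalLine W p Φ → ¬ LineUnramifiedAt W p Φ) →
      ∀ (K : Type) [Field K] [NumberField K], IsImaginaryQuadratic K →
        SatisfiesHeegnerHypothesis (W.conductorNorm ℤ) K → SatisfiesHeegnerHypothesis p K →
        Odd (NumberField.discr K) → NumberField.discr K ≠ -3 →
        (∀ Q : (W.baseChange K).toAffine.Point, p • Q = 0 → Q = 0) →
        (W.baseChange K).selmerCorank p = 1 →
      ∀ (ι : K →+* ℚ_[p]) (v vbar : HeightOneSpectrum (𝓞 K)),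
        (∀ x : 𝓞 K, x ∈ v.asIdeal ↔ ‖ι (x : K)‖ < 1) →
        ((p : ℕ) : 𝓞 K) ∈ vbar.asIdeal → vbar ≠ v →
      ∀ (κ : ZpExtension K p), κ.IsAnticyclotomic →
      ∀ (γ : absoluteGaloisGroup K) [Fact (κ.IsTopGenerator γ)],
      ∀ (N : ℕ) [NeZero N] (Dt : ModularParametrizationData W N)
        (H : HeegnerDatum N (NumberField.discr K)) (ιC : K →+* ℂ) (P : (W.baseChange K).toAffine.Point),
        WeierstrassCurve.Affine.Point.map ιC.toRatAlgHom P = heegnerPointComplex Dt H →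
      ∀ (W' : WeierstrassCurve ℚ) [W'.IsElliptic] [W'.IsGloballyMinimal], IsIsogenous W W' →
        Module.IsTorsion (IwasawaAlgebra p) (AcSelmer.XAc (W'.baseChange K) p κ vbar ∅ γ) ∧
        ∃ F : IwasawaAlgebra p,
          AcSelmer.XAc.charIdeal (W'.baseChange K) p κ vbar ∅ γ = Ideal.span {F} ∧
          ∃ u : ℤ_[p]ˣ,
            ((PowerSeries.constantCoeff F : ℤ_[p]) : ℚ_[p]) =
              ((u : ℤ_[p]) : ℚ_[p]) * ((Dt.c : ℚ_[p])⁻¹) ^ 2 *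
                (1 - (W.frobeniusTrace p : ℚ_[p]) * (p : ℚ_[p])⁻¹ + (p : ℚ_[p])⁻¹) ^ 2 *
                ((W.baseChange ℚ_[p]).padicLogPoint (formalIndex W p • padicPointOf W p ι P) /
                  (formalIndex W p : ℚ_[p])) ^ 2 := by
  intro W _ _ p _ hp hgood hred hanom hGL K _ _ hK hHN hHp hodd h3 hEK hSel ι v vbar hv hvbar hne κ hκ γ _
    N _ Dt H ιC P hP W' _ _ hiso
  -- crux 2 at the good lattice: torsion, a generator and the value
  obtain ⟨htors, F, hF, u, hu⟩ := h2 W p hp hgood hred hanom hGL K hK hHN hHp hodd h3 hEK hSel ι v vbar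
    hv hvbar hne κ hκ γ N Dt H ιC P hP
  -- `v ∋ p` from the embedding
  have hvp : ((p : ℕ) : 𝓞 K) ∈ v.asIdeal := by
    rw [hv]
    simp only [map_natCast]
    exact Padic.norm_p_lt_one
  -- Kobayashi–Ota: the characteristic ideal does not change along the isogeny
  obtain ⟨htors', hchar⟩ := hKO W W' p hp hgood hiso K hK hHN hHp hodd h3 v vbar hvp hvbar hne κ hκ γ htors
  exact ⟨htors', F, hchar ▸ hF, u, hu⟩

end Summit.BirchSwinnertonDyer.BirchSwinnertonDyer.Theorems.InterludeWithTorsion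

end
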